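/-
Origin: expansion seat `planner-pub-hodgecm-pv05-0`, handover 2026-08-18T04:14:23Z (optional smoke) (`HOME/pub-hodgecm-pv05/lean/Pv05/DoublingSmoke.lean`, md5 bbde4ea0, 56 lines);
landed by the gen-5 packager in gate run 21 as `HodgeCM/PerL34/DoublingSmoke.lean` (verbatim).
-/
/-
pub-hodgecm speedrun cell, prover pv05 — WIP module `Pv05.DoublingSmoke` (proposed landing place
`HodgeCM/PerL34/DoublingSmoke.lean`; OPTIONAL smoke file).  Imports: LANDED `HodgeCM.PerL34.Doubling` only.

# Smoke test (non-vacuity) of the posited N31b shell `DoublingDatum`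

Everything downstream of N31b (pv11 `EqBasicDatum`, pv05 `DoublingBridge` / `DoublingTheta`, pv15 `SiegelWeilGlue`,
pv09 `RallisIP`) is quantified `∀ D : DoublingDatum A H S Sbox`.  This file exhibits an INSTANCE, so the record of
hypotheses (`ι_injective`, `norm_χV`, `equivariant`, `ev0_δ` with the fixed orientation `pair φ₁ φ₂ = ⟪φ₂, φ₁⟫_ℂ`) is
CONSISTENT (vacuity audit A1: the shell is inhabited): the "rank-zero" model `H := A × A`, `ι := id`, `ω := 1`,
`ω^□ := 1`, `χ_V := 1`, `Sbox := ℂ`, `δ(φ₁ ⊗ φ̄₂) := ⟨φ₁, φ₂⟩` (the flipped `innerₛₗ`), `ev0 := id` — for ANY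
commutative group `A` and ANY complex inner-product space `S`.  It says nothing about PerL; it only certifies that the
typed hypotheses of N31b do not contradict each other (in particular the conjugate-linearity / twist conventions).
-/
import Summits.HodgeConjecture.HodgeCM.PerL34.Doubling_2

/-! PORT of `HodgeCM/PerL34/DoublingSmoke.lean` (HodgeCMPerL run 81) — verbatim mechanical port; provenance in the PORT header line. -/

set_option autoImplicit false

noncomputable section

open scoped InnerProductSpace

namespace HodgeCM
namespace PerL34
namespace Doubling
namespace DoublingDatum

variable (A : Type*) [CommGroup A] (S : Type*) [NormedAddCommGroup S] [InnerProductSpace ℂ S]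

/-- The rank-zero model of the doubling shell (smoke instance). -/
def trivialModel : DoublingDatum A (A × A) S ℂ where
  ι := MonoidHom.id (A × A)
  ι_injective := fun _ _ h => h
  ω := 1
  ωbox := 1
  ev0 := LinearMap.id
  χV := 1
  norm_χV := fun a => by simp
  δ := (innerₛₗ ℂ (E := S)).flip
  equivariant := fun h₁ h₂ φ₁ φ₂ => by simp
  ev0_δ := fun φ₁ φ₂ => by simp [pair_def]

/-- The N31b shell is inhabited (for every `A`, `S`). -/
theorem nonempty_doublingDatum : Nonempty (DoublingDatum A (A × A) S ℂ) := ⟨trivialModel A S⟩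

/-- In the model, `f_Φ(ι(h₁,h₂)) = ⟪φ, φ⟫ = ‖φ‖²` for `Φ = δ(φ ⊗ φ̄)` — (eq:basic) with `χ_V = 1`, `ω = 1`. -/
theorem trivialModel_fSW (φ : S) (h₁ h₂ : A) :
    (trivialModel A S).fSW ((trivialModel A S).Φ φ) (h₁, h₂) = ⟪φ, φ⟫_ℂ := by
  simp [fSW_def, Φ_def, trivialModel]

end DoublingDatum
end Doubling
end PerL34
end HodgeCM

end
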